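import Literature.IUT.HodgeTheaters.PMBaseIsoTorsorSchemaClosure
import Literature.IUT.HodgeTheaters.PMBaseNegCompatLiftCriteria

/-!
# [IUTchI] Prop 6.6 (ii) / Prop 6.8 (i) from the TWISTED `[−1]`-compatibility of `φ^{Θell}_{•,v}`

S. Mochizuki, *Inter-universal Teichmüller theory I: construction of Hodge theaters*, §6, Example 6.3 (i),
(ii) pp. 160–161, Proposition 6.6 (ii) p. 165, Proposition 6.8 (i) pp. 167–168 of the kurims manuscript (May
2020) [claim: Mochizuki2012, status: disputed].  PROOF-ONLY companion (theorems, no definitions) of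
abc-iut-L5-t4's `PMBaseBridgeProps.lean` (abc-iut cell, block F fact-proving wave, seat abc-iut-f-071 gen 4;
FACT-LIST row F-2018 `IsoTorsor`, Prop 6.6 (ii): the EXACT side condition over a kit, first half).

WHAT IS PROVED.  abc-iut-L5-t13 derived Prop 6.6 (ii) (`DThetaEllBridge.IsoTorsor B₁ B₂` for all
`𝒟-Θ^{ell}`-bridges) and Prop 6.8 (i) from the equivariance of Example 6.3 (ii) for NEGATIVE `γ ∈ 𝔽_l^{⋊±}`,
equivalently (abc-iut-w5-d086 / f-071 gen 3, `Ex63.negCompatModel_iff_forall_equivariant`) from the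
`[−1]`-compatibility `Ex63.NegCompatModel K`: at every `v` a negative automorphism `a_v` of `𝒟_v` and a lift
`b ∈ Aut_±(𝒟^{⊚±})` of `(0, −1)` with `a_v ≫ φ^{Θell}_{•,v} = φ^{Theta ell}_{•,v} ≫ b`.  Here the SAME conclusions
are derived from the WEAKER, TWISTED form — a lift of `(d, −1)` for one `d ∈ 𝔽_l` common to all `v`
(`d = 0` is `NegCompatModel`):

* `Ex63.twEquivariant_of_twistedNegCompat` — the twisted form yields, for every negative `γ`, the
  equivariance square of Example 6.3 (ii) with `γ` as index shift on `𝔇_±` but the lift of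
  `δ := γ · (−d, +1)` on `𝒟^{⊚±}` (a "two-element" equivariance; for `d = 0` it is `Ex63.Equivariant K γ`);
* `ellConj_global_side_of_twEquivariant`, `DThetaEllBridge.Iso.exists_of_twEquivariant` — abc-iut-L5-t13's
  global-side lemma and construction of isomorphisms of `𝒟-Θ^{ell}`-bridges, run with such a pair `(γ, δ)`;
* `DThetaEllBridge.isoTorsor_of_twistedNegCompat` — **Prop 6.6 (ii) from the twisted form**;
  `DThetaPMEllHT.ellBridgeSymmetry_of_twistedNegCompat` — **Prop 6.8 (i) from the twisted form**.

The companion file `PMBaseIsoTorsorExactSideCondition.lean` proves the converse (Prop 6.6 (ii) for the model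
bridge forces the twisted form), the resulting `iff`, and exhibits a kit where the twisted form holds with
`d ≠ 0` while `Ex63.NegCompatModel` fails — so Prop 6.6 (ii) over a kit is STRICTLY weaker than (β).

Nothing here takes a side on [IUTchIII] Cor. 3.12 or asserts anything about the genuine objects of [IUTchI];
typed ≠ proved; a FACT-LIST row is an assumption label, proved/refuted = OUR kernel check only.
-/

namespace Literature.IUT.HodgeTheaters

open CategoryTheory

universe u

namespace PMBaseKit

variable {l : ℕ} {K : PMBaseKit.{u} l}

namespace Ex63

/-- **Twisted `[−1]`-compatibility ⇒ two-element equivariance** ([IUTchI] Ex 6.3 (ii) p. 161, twisted):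
if at every `v` some NEGATIVE automorphism `a` of `𝒟_v` and some lift `b` of `(d, −1) ∈ 𝔽_l^{⋊±}` satisfy
`a ≫ φ^{Θell}_{•,v} = φ^{Θell}_{•,v} ≫ b`, then for every negative `γ` and every `(t, v)`: post-composing
`φ^{Θell}_{v_t}` with the lifts of `δ := γ · (−d, +1)` equals pre-composing `φ^{Θell}_{v_{γ t}}` with the negative
`+`-full poly-automorphism of `𝒟_{v_t}`.  (abc-iut-L5-t13's `equivariant_of_negCompat` is the case `d = 0`.)
[claim: Mochizuki2012, status: disputed] -/
theorem twEquivariant_of_twistedNegCompat {d : ZMod l}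
    (htw : ∀ v, ∃ a : K.model v ≅ K.model v, K.labMap v a = labNeg (K.isLocal_model v) ∧
      ∃ b ∈ lifts K (FlPM.mk d (-1)), a.hom ≫ K.phiEll v = K.phiEll v ≫ (K.atV v).map b.hom)
    {γ : FlPM l} (hγ : γ.IsNegative) (t : ZMod l) (v : K.V) :
    {h | ∃ f ∈ poly K t v, ∃ b ∈ lifts K (γ * FlPM.transl (-d)), h = f ≫ (K.atV v).map b.hom} =
      {h | ∃ p ∈ (DStrip.model K).signedPolyAut (fun _ => γ.right),
        ∃ g ∈ poly K (γ • t) v, h = (p v).hom ≫ g} := by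
  obtain ⟨a, ha, b₀, hb₀, hcomp⟩ := htw v
  have hγr : γ.right = -1 := hγ
  rw [hγr]
  -- the two permutation identities behind the bookkeeping of lifts
  have hperm₁ : FlPM.toPerm l (γ * FlPM.transl (-d) * (FlPM.transl t * FlPM.mk d (-1))) =
      FlPM.toPerm l (FlPM.transl (γ • t)) := by
    ext z
    simp only [map_mul, Equiv.Perm.mul_apply, FlPM.toPerm_apply, FlPM.mk_smul, FlPM.transl_smul,
      FlPM.smul_def γ, hγr, Units.neg_smul, one_smul]
    ring
  have hperm₂ : FlPM.toPerm l (FlPM.transl (γ • t) * ((FlPM.mk d (-1))⁻¹ * (FlPM.transl t)⁻¹)) =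
      FlPM.toPerm l (γ * FlPM.transl (-d)) := by
    ext z
    have h1 : (FlPM.toPerm l (FlPM.transl t)).symm z = z - t := by
      rw [Equiv.symm_apply_eq]; simp [FlPM.transl_smul]
    have h2 : (FlPM.toPerm l (FlPM.mk (l := l) d (-1))).symm (z - t) = -(z - t) + d := by
      rw [Equiv.symm_apply_eq]; simp [FlPM.mk_smul]
    simp only [map_mul, map_inv, Equiv.Perm.mul_apply, Equiv.Perm.inv_def, h1, h2, FlPM.toPerm_apply,
      FlPM.transl_smul, FlPM.smul_def γ, hγr, Units.neg_smul, one_smul]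
    ring
  -- `a⁻¹ ≫ φ = φ ≫ b₀⁻¹`
  have hcomp' : a.inv ≫ K.phiEll v = K.phiEll v ≫ (K.atV v).map b₀.inv := by
    rw [← cancel_epi a.hom, ← Category.assoc, a.hom_inv_id, Category.id_comp, ← Category.assoc, hcomp,
      Category.assoc, ← Functor.map_comp, Iso.hom_inv_id, CategoryTheory.Functor.map_id, Category.comp_id]
  ext h
  constructor
  · rintro ⟨f, ⟨ap, hap, bt, hbt, rfl⟩, b, hb, rfl⟩
    have hapv : K.labMap v ap = Equiv.refl _ := (K.mem_autPlus_iff ap).mp hap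
    obtain ⟨s, hs⟩ := DStrip.exists_mem_signedPolyAut (DStrip.model K) (fun _ => (-1 : ℤˣ))
    have hmem : b₀ ≪≫ bt ≪≫ b ∈ lifts K (FlPM.transl (γ • t)) := by
      rw [← lifts_eq_of_toPerm_eq hperm₁]
      have h := trans_mem_lifts (trans_mem_lifts hb₀ hbt) hb
      simpa only [Iso.trans_assoc] using h
    have hneg_v : K.labMap v (ap ≪≫ a.symm) = labNeg (K.isLocal_model v) := by
      rw [K.labMap_trans, hapv, Equiv.refl_trans, labMap_symm, ha]
      ext x
      rw [Equiv.symm_apply_eq]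
      have := congrArg (fun e => e x) (labNeg_trans_labNeg (K.isLocal_model v))
      simpa using this.symm
    obtain ⟨p, hp, hpv⟩ : ∃ p ∈ (DStrip.model K).signedPolyAut (fun _ => (-1 : ℤˣ)), p v = ap ≪≫ a.symm := by
      classical
      refine ⟨fun w => if hw : w = v then hw ▸ (ap ≪≫ a.symm) else s w, ?_, by simp⟩
      rw [DStrip.mem_signedPolyAut_iff] at hs ⊢
      intro w
      by_cases hw : w = v
      · subst hw
        simp only [dite_true]
        rw [hneg_v]
        exact ⟨fun h => absurd h (labNeg_ne_refl _), fun h => absurd h (by decide)⟩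
      · simp only [hw, dite_false]
        exact hs w
    refine ⟨p, hp, K.phiEll v ≫ (K.atV v).map (b₀ ≪≫ bt ≪≫ b).hom,
      ⟨Iso.refl _, (K.mem_autPlus_iff _).mpr (K.labMap_refl v _), _, hmem, by simp⟩, ?_⟩
    rw [hpv]
    simp only [Iso.trans_hom, Iso.symm_hom, Functor.map_comp, Category.assoc]
    rw [reassoc_of% hcomp']
    simp only [Iso.map_inv_hom_id_assoc]
  · rintro ⟨p, hp, g, ⟨ap, hap, b'', hb'', rfl⟩, rfl⟩
    have hpv : K.labMap v (p v) = labNeg (K.isLocal_model v) := by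
      have := (DStrip.mem_signedPolyAut_iff _ _).mp hp v
      rcases labMap_eq_refl_or_labNeg (K.isLocal_model v) (p v) with h | h
      · exact absurd (this.mp h) (by decide)
      · exact h
    have hapv : K.labMap v ap = Equiv.refl _ := (K.mem_autPlus_iff ap).mp hap
    obtain ⟨bt, hbt⟩ := lifts_nonempty (K := K) (FlPM.transl t)
    have hq : K.labMap v (((p v : K.model v ≅ K.model v) ≪≫ (ap : K.model v ≅ K.model v)) ≪≫ a) =
        Equiv.refl _ := by
      rw [K.labMap_trans, K.labMap_trans, hpv, hapv, ha, Equiv.trans_refl, labNeg_trans_labNeg]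
    have hb : bt.symm ≪≫ b₀.symm ≪≫ b'' ∈ lifts K (γ * FlPM.transl (-d)) := by
      rw [← lifts_eq_of_toPerm_eq hperm₂]
      have h := trans_mem_lifts (trans_mem_lifts (symm_mem_lifts hbt) (symm_mem_lifts hb₀)) hb''
      simpa only [Iso.trans_assoc] using h
    refine ⟨(((p v : K.model v ≅ K.model v) ≪≫ (ap : K.model v ≅ K.model v)) ≪≫ a).hom ≫ K.phiEll v ≫
        (K.atV v).map bt.hom,
      ⟨((p v : K.model v ≅ K.model v) ≪≫ (ap : K.model v ≅ K.model v)) ≪≫ a, (K.mem_autPlus_iff _).mpr hq,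
        bt, hbt, rfl⟩, _, hb, ?_⟩
    simp only [Iso.trans_hom, Iso.symm_hom, Functor.map_comp, Category.assoc]
    rw [reassoc_of% hcomp]
    simp only [Iso.map_hom_inv_id_assoc]

end Ex63

/-! ### The global side of the compatibility square for a two-element equivariance -/

/-- **Global side, two-element form** ([IUTchI] Ex 6.3 (ii) p. 161; Def 6.4 (ii) p. 163): GIVEN the
equivariance square at `(z, v)` with index shift `γ` and global lifts of `δ`, post-composing
`ellConj a β₁ (φ^{Θell}_{v_z})` with the `Aut_csp(‡𝒟^{⊚±})`-orbit of `β₁⁻¹ ∘ b ∘ β₂`, `b` a lift of `δ`, gives the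
conjugate by the sign-twisted `a` of `φ^{Θell}_{v_{γ z}}` (abc-iut-L5-t13's `ellConj_global_side_of_equivariant` is
the case `δ = γ`). [claim: Mochizuki2012, status: disputed] -/
theorem ellConj_global_side_of_twEquivariant {C : K.DStrip} {G₁ G₂ : K.Glob} (a : (DStrip.model K).Iso C)
    (β₁ : K.gModel ≅ G₁) (β₂ : K.gModel ≅ G₂) (z : ZMod l) (v : K.V) {γ δ : FlPM l}
    (hEq : {h | ∃ f ∈ Ex63.poly K z v, ∃ b ∈ Ex63.lifts K δ, h = f ≫ (K.atV v).map b.hom} =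
      {h | ∃ p ∈ (DStrip.model K).signedPolyAut (fun _ => γ.right),
        ∃ g ∈ Ex63.poly K (γ • z) v, h = (p v).hom ≫ g})
    {b : Aut K.gModel} (hb : b ∈ Ex63.lifts K δ)
    {s : (DStrip.model K).Iso (DStrip.model K)} (hs : s ∈ (DStrip.model K).signedPolyAut fun _ => γ.right) :
    {h | ∃ f ∈ K.ellConj a β₁ v (Ex63.poly K z v),
      ∃ q ∈ {ψ : G₁ ≅ G₂ | ∃ c' ∈ K.autCsp G₂, ψ = (β₁.symm ≪≫ b ≪≫ β₂) ≪≫ c'},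
        h = f ≫ (K.atV v).map (q : G₁ ≅ G₂).hom} =
      K.ellConj (s.symm.trans a) β₂ v (Ex63.poly K (γ • z) v) := by
  ext h
  constructor
  · rintro ⟨f, ⟨f₀, hf₀, rfl⟩, q, ⟨c', hc', rfl⟩, rfl⟩
    obtain ⟨c', rfl⟩ : ∃ c'' : G₂ ≅ G₂, c'' = c' := ⟨c', rfl⟩
    have hc'' : (β₂ ≪≫ c' ≪≫ β₂.symm : Aut K.gModel) ∈ K.autCsp K.gModel := conj_mem_autCsp β₂ hc'
    have hmem : f₀ ≫ (K.atV v).map (b ≪≫ (β₂ ≪≫ c' ≪≫ β₂.symm)).hom ∈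
        {h | ∃ p ∈ (DStrip.model K).signedPolyAut (fun _ => γ.right),
          ∃ g ∈ Ex63.poly K (γ • z) v, h = (p v).hom ≫ g} := by
      rw [← hEq]
      exact ⟨f₀, hf₀, _, Ex63.trans_csp_mem_lifts hb hc'', rfl⟩
    obtain ⟨p, hp, g, hg, hpg⟩ := hmem
    rw [DStrip.signedPolyAut_eq_plusFullPolyIso hs] at hp
    obtain ⟨ap, hap, rfl⟩ := hp
    have hapv : K.labMap v (ap v) = Equiv.refl _ :=
      (K.mem_autPlus_iff _).mp (((DStrip.model K).mem_autPlus_iff ap).mp hap v)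
    refine ⟨(ap v).hom ≫ g, Ex63.pre_mem_poly hapv hg, ?_⟩
    change ((a v).inv ≫ f₀ ≫ (K.atV v).map β₁.hom) ≫ (K.atV v).map ((β₁.symm ≪≫ b ≪≫ β₂) ≪≫ c').hom =
      ((s v).symm ≪≫ a v).inv ≫ ((ap v).hom ≫ g) ≫ (K.atV v).map β₂.hom
    have hpg' : f₀ ≫ (K.atV v).map b.hom ≫ (K.atV v).map β₂.hom ≫ (K.atV v).map c'.hom =
        (s v).hom ≫ (ap v).hom ≫ g ≫ (K.atV v).map β₂.hom := by
      have h := congrArg (· ≫ (K.atV v).map β₂.hom) hpg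
      simpa [Functor.map_comp, Category.assoc] using h
    simp only [Iso.trans_hom, Iso.symm_hom, Functor.map_comp, Category.assoc, Iso.trans_inv, Iso.symm_inv,
      Iso.map_hom_inv_id_assoc]
    rw [hpg']
  · rintro ⟨g, hg, rfl⟩
    have hmem : (s v).hom ≫ g ∈ {h | ∃ f ∈ Ex63.poly K z v, ∃ b ∈ Ex63.lifts K δ,
        h = f ≫ (K.atV v).map b.hom} := by
      rw [hEq]
      exact ⟨s, hs, g, hg, rfl⟩
    obtain ⟨f₀, hf₀, b', hb', hfb⟩ := hmem
    obtain ⟨c, hc, rfl⟩ := Ex63.exists_csp_of_mem_lifts hb hb'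
    refine ⟨(a v).inv ≫ f₀ ≫ (K.atV v).map β₁.hom, ⟨f₀, hf₀, rfl⟩,
      (β₁.symm ≪≫ b ≪≫ β₂) ≪≫ (β₂.symm ≪≫ c ≪≫ β₂), ⟨β₂.symm ≪≫ c ≪≫ β₂, ?_, rfl⟩, ?_⟩
    · show K.gLabMap (β₂.symm ≪≫ c ≪≫ β₂) = Equiv.refl _
      have hc1 : K.gLabMap c = Equiv.refl _ := MonoidHom.mem_ker.mp hc
      rw [K.gLabMap_trans, K.gLabMap_trans, hc1, Equiv.refl_trans, ← K.gLabMap_trans, Iso.symm_self_id,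
        K.gLabMap_refl]
    · change ((s v).symm ≪≫ a v).inv ≫ g ≫ (K.atV v).map β₂.hom = _
      simp only [Iso.trans_inv, Iso.symm_inv, Category.assoc, Iso.trans_hom, Iso.symm_hom, Functor.map_comp]
      rw [reassoc_of% hfb]
      simp [← Functor.map_comp]

namespace DThetaEllBridge

/-- **Construction under a two-element equivariance** ([IUTchI] Prop 6.6 (ii) p. 165): for
`𝒟-Θ^{ell}`-bridges exhibited by `(ι₁, α₁, β₁)`, `(ι₂, α₂, β₂)` and a pair `(γ, δ)` of elements of `𝔽_l^{⋊±}`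
whose two-element equivariance square holds at every `(z, v)`, there is an isomorphism of `𝒟-Θ^{ell}`-bridges
with index bijection `ι₂ ∘ γ ∘ ι₁⁻¹` — its global constituent is (the orbit of) a lift of `δ`
(abc-iut-L5-t13's `Iso.exists_of_equivariant` is the case `δ = γ`). [claim: Mochizuki2012, status: disputed] -/
theorem Iso.exists_of_twEquivariant (B₁ B₂ : K.DThetaEllBridge)
    {ι₁ : ZMod l ≃ B₁.T} (hι₁ : ∀ e ∈ B₁.torT.charts, ι₁.trans e ∈ (FlPMTorsor.tautological l).charts)
    {α₁ : ∀ z, (DStrip.model K).Iso (B₁.capsule (ι₁ z))} {β₁ : K.gModel ≅ B₁.glob}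
    (h₁ : ∀ z v, B₁.poly (ι₁ z) v = K.ellConj (α₁ z) β₁ v (Ex63.poly K z v))
    {ι₂ : ZMod l ≃ B₂.T} (hι₂ : ∀ e ∈ B₂.torT.charts, ι₂.trans e ∈ (FlPMTorsor.tautological l).charts)
    {α₂ : ∀ z, (DStrip.model K).Iso (B₂.capsule (ι₂ z))} {β₂ : K.gModel ≅ B₂.glob}
    (h₂ : ∀ z v, B₂.poly (ι₂ z) v = K.ellConj (α₂ z) β₂ v (Ex63.poly K z v))
    (γ δ : FlPM l)
    (hE : ∀ (z : ZMod l) (v : K.V),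
      {h | ∃ f ∈ Ex63.poly K z v, ∃ b ∈ Ex63.lifts K δ, h = f ≫ (K.atV v).map b.hom} =
        {h | ∃ p ∈ (DStrip.model K).signedPolyAut (fun _ => γ.right),
          ∃ g ∈ Ex63.poly K (γ • z) v, h = (p v).hom ≫ g}) :
    ∃ g : Iso B₁ B₂, g.indexEquiv = ι₁.symm.trans ((FlPM.toPerm l γ).trans ι₂) := by
  obtain ⟨b, hb⟩ := Ex63.lifts_nonempty (K := K) δ
  obtain ⟨s, hs⟩ := DStrip.exists_mem_signedPolyAut (DStrip.model K) (fun _ => γ.right)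
  let α₁' : ∀ t : B₁.T, (DStrip.model K).Iso (B₁.capsule t) := fun t v =>
    α₁ (ι₁.symm t) v ≪≫ eqToIso (congrArg (fun s => (B₁.capsule s).obj v) (ι₁.apply_symm_apply t))
  have hα₁' : ∀ z, α₁' (ι₁ z) = α₁ z := fun z =>
    DStrip.isoCast_eq (fun s => B₁.capsule (ι₁ s)) _ α₁ (ι₁.symm_apply_apply z)
  refine ⟨{ indexEquiv := ι₁.symm.trans ((FlPM.toPerm l γ).trans ι₂)
            indexEquiv_charts := fun e he => ?_
            capsPoly := fun t =>
              DStrip.plusFullPolyIso ((s.symm.trans (α₁' t)).symm.trans (α₂ (γ • ι₁.symm t)))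
            capsPoly_plusFull := fun t => ⟨_, rfl⟩
            globPoly := {ψ | ∃ c' ∈ K.autCsp B₂.glob, ψ = (β₁.symm ≪≫ b ≪≫ β₂) ≪≫ c'}
            globPoly_orbit := ⟨_, rfl⟩
            compat := fun t v => ?_ }, rfl⟩
  · rw [Equiv.trans_assoc, Equiv.trans_assoc]
    refine B₁.torT.symm_trans_mem_of_compat hι₁ ?_
    obtain ⟨g, hg⟩ := hι₂ e he
    refine ⟨g * γ, ?_⟩
    show FlPM.toPerm l (g * γ) = (FlPM.toPerm l γ).trans (ι₂.trans e)
    rw [map_mul, Equiv.Perm.mul_def, show FlPM.toPerm l g = ι₂.trans e from hg]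
  · obtain ⟨z, rfl⟩ := ι₁.surjective t
    change {h | ∃ p ∈ DStrip.plusFullPolyIso ((s.symm.trans (α₁' (ι₁ z))).symm.trans
        (α₂ (γ • ι₁.symm (ι₁ z)))), ∃ g ∈ B₂.poly (ι₂ (γ • ι₁.symm (ι₁ z))) v, h = (p v).hom ≫ g} =
      {h | ∃ f ∈ B₁.poly (ι₁ z) v,
        ∃ q ∈ {ψ : B₁.glob ≅ B₂.glob | ∃ c' ∈ K.autCsp B₂.glob, ψ = (β₁.symm ≪≫ b ≪≫ β₂) ≪≫ c'},
          h = f ≫ (K.atV v).map (q : B₁.glob ≅ B₂.glob).hom}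
    rw [hα₁', h₂, h₁, ellConj_capsule_side, ellConj_global_side_of_twEquivariant (α₁ z) β₁ β₂ z v (hE z v) hb hs,
      Equiv.symm_apply_apply]

/-- **[IUTchI] Prop 6.6 (ii), surjectivity — from the TWISTED `[−1]`-compatibility** (p. 165): every
isomorphism of `𝔽_l^±`-torsors between the index sets is induced by an isomorphism of `𝒟-Θ^{ell}`-bridges —
positive ones unconditionally (abc-iut-L5-t13), negative ones `κ = ι₂ ∘ γ ∘ ι₁⁻¹` through the two-element
equivariance `(γ, γ·(−d, +1))`. [claim: Mochizuki2012, status: disputed] -/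
theorem isoTorsor_surjective_of_twistedNegCompat {d : ZMod l}
    (htw : ∀ v, ∃ a : K.model v ≅ K.model v, K.labMap v a = labNeg (K.isLocal_model v) ∧
      ∃ b ∈ Ex63.lifts K (FlPM.mk d (-1)), a.hom ≫ K.phiEll v = K.phiEll v ≫ (K.atV v).map b.hom)
    (B₁ B₂ : K.DThetaEllBridge) :
    Function.Surjective fun g : Iso B₁ B₂ =>
      (⟨g.indexEquiv, g.indexEquiv_charts⟩ : {ι : B₁.T ≃ B₂.T // B₁.torT.Compat B₂.torT ι}) := by
  rintro ⟨κ, hκ⟩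
  obtain ⟨ι₁, hι₁, α₁, β₁, h₁⟩ := B₁.exists_model
  obtain ⟨ι₂, hι₂, α₂, β₂, h₂⟩ := B₂.exists_model
  have hκ₀ : ι₁.trans (κ.trans ι₂.symm) ∈ (FlPMTorsor.tautological l).charts := by
    have h := hι₁ _ (hκ _ (B₂.torT.symm_trans_mem_of_compat hι₂ (e₀ := Equiv.refl _) ⟨1, by
      show FlPM.toPerm l 1 = _; rw [map_one]; rfl⟩))
    simpa only [Equiv.trans_refl] using h
  obtain ⟨γ, hγ⟩ := hκ₀
  have hκeq : κ = ι₁.symm.trans ((FlPM.toPerm l γ).trans ι₂) := by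
    ext t
    have ht := congrArg (fun f : ZMod l ≃ ZMod l => ι₂ (f (ι₁.symm t))) hγ
    simpa using ht.symm
  rcases FlPM.isPositive_or_isNegative γ with hpos | hneg
  · obtain ⟨g, hg⟩ := Iso.exists_of_equivariant B₁ B₂ hι₁ h₁ hι₂ h₂ γ (Ex63.equivariant_of_isPositive hpos)
    exact ⟨g, Subtype.ext (hg.trans hκeq.symm)⟩
  · obtain ⟨g, hg⟩ := Iso.exists_of_twEquivariant B₁ B₂ hι₁ h₁ hι₂ h₂ γ (γ * FlPM.transl (-d))
      (fun z v => Ex63.twEquivariant_of_twistedNegCompat htw hneg z v)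
    exact ⟨g, Subtype.ext (hg.trans hκeq.symm)⟩

/-- **[IUTchI] Prop 6.6 (ii) — PROVED from the TWISTED `[−1]`-compatibility of `φ^{Θell}_{•,v}`**: if for
ONE `d ∈ 𝔽_l` every `φ^{Θell}_{•,v}` intertwines some negative automorphism of `𝒟_v` with a lift of `(d, −1)`,
then `DThetaEllBridge.IsoTorsor B₁ B₂` holds for all `𝒟-Θ^{ell}`-bridges (nonempty; index bijection a bijection
onto the isomorphisms of `𝔽_l^±`-torsors).  `d = 0` is abc-iut-L5-t13's `isoTorsor_of_negCompat`.
[claim: Mochizuki2012, status: disputed] -/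
theorem isoTorsor_of_twistedNegCompat {d : ZMod l}
    (htw : ∀ v, ∃ a : K.model v ≅ K.model v, K.labMap v a = labNeg (K.isLocal_model v) ∧
      ∃ b ∈ Ex63.lifts K (FlPM.mk d (-1)), a.hom ≫ K.phiEll v = K.phiEll v ≫ (K.atV v).map b.hom)
    (B₁ B₂ : K.DThetaEllBridge) : IsoTorsor B₁ B₂ := fun hV =>
  ⟨isoTorsor_nonempty B₁ B₂, isoTorsor_injective hV B₁ B₂, isoTorsor_surjective_of_twistedNegCompat htw B₁ B₂⟩

end DThetaEllBridge

/-- **[IUTchI] Prop 6.8 (i) — PROVED from the TWISTED `[−1]`-compatibility of `φ^{Θell}_{•,v}`** (pp. 167–168: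
the `𝔽_l^{⋊±}`-symmetry of a `𝒟-Θ^{±ell}`-Hodge theater, "transitively with stabilizers of order two"): via
Prop 6.6 (ii) for the pair `(B, B)` (f-071 gen 3's `DThetaPMEllHT.ellBridgeSymmetry_of_isoTorsor`).
[claim: Mochizuki2012, status: disputed] -/
theorem DThetaPMEllHT.ellBridgeSymmetry_of_twistedNegCompat {d : ZMod l}
    (htw : ∀ v, ∃ a : K.model v ≅ K.model v, K.labMap v a = labNeg (K.isLocal_model v) ∧
      ∃ b ∈ Ex63.lifts K (FlPM.mk d (-1)), a.hom ≫ K.phiEll v = K.phiEll v ≫ (K.atV v).map b.hom)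
    (H : K.DThetaPMEllHT) : DThetaPMEllHT.EllBridgeSymmetry H :=
  DThetaPMEllHT.ellBridgeSymmetry_of_isoTorsor H
    (DThetaEllBridge.isoTorsor_of_twistedNegCompat htw H.ellBridge H.ellBridge)

end PMBaseKit

end Literature.IUT.HodgeTheaters
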